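import Summits.BirchSwinnertonDyer.BirchSwinnertonDyer.Theorems.TeichmullerTwistDescentCellsFromResidue
import HarnessLib

/-!
# Route `TeichmullerTwistDescent`, cruxes PSMU (stmt-BirchSwinnertonDyer-22638) / SCMU57
# (stmt-BirchSwinnertonDyer-22639) from the REGISTERED stubs of route AdditiveKolyvaginRoad's crux
# `ManinFrameResidueProperR` (stmt-BirchSwinnertonDyer-20709, line `birth`), signatures verbatim (`--supports`)

Cell `pub/bsd-wall` (D-0145 line route-BirchSwinnertonDyer-TeichmullerTwistDescent, DRAFT rev 0), seat
`bsd-line-ttd-p2` (prover 2/2, g0). THEOREMS ONLY (no definition, no named fact, no `sorry`); nothing is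
booked, no item is closed, BSD is not proved by this.

Sequel of `TeichmullerTwistDescentCellsFromResidue.lean` (p581427/p581687), whose §3 took the twist-degree
step WITHOUT the universal degree clause. Here the hypotheses are the REGISTERED stub signatures of
`Cruxes/ManinFrameResidueProperR/Lines/birth.lean` VERBATIM after `hnf` — `stub_twistDegreeStep` with its
residue clause `hres` AND universal degree clause `hall`, `stub_memberManinUnit_fiveSeven` likewise — so
that, once AKR's line `birth` lands them as theorems, the T10-restated PSMU
(`edixhoven_not_dvd_maninConstant_of_kodairaSymbol_ne → exists_isNewformOf → <body>`) closes by `exact`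
(granted also `hEdx`, `hDD`, `hCNS`, conjuncts of the route's `PublishedManinFacts`). Off the proper residue
(`¬ hall`) the degree class is Česnavičius–Neururer–Saha Thm. 1.2
(`ManinFrameTransport.exists_modularParametrizationData_not_dvd_of_not_dvd_modularDegree`).
[cite: EdixhovenManin1991, Thm. 3 and §4] [cite: CesnaviciusNeururerSaha2023, Thm. 1.2]
[cite: DokchitserDokchitser2015LocalInvariants, Thm. 5.1 (1)]
-/

set_option autoImplicit false
-- single-conjunct summit: `Summit.BirchSwinnertonDyer.BirchSwinnertonDyer.…` repeats the name by design
set_option linter.dupNamespace false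

noncomputable section

open scoped Classical

open WeierstrassCurve IsDedekindDomain Rat.HeightOneSpectrum
  Literature.NumberTheory.EllipticCurves Literature.NumberTheory.EllipticCurves.ModularForms
  Literature.NumberTheory.EllipticCurves.Rank1Residual Literature.NumberTheory.DiophantineGeometry
  Summit.BirchSwinnertonDyer.Rank1Residual Summit.BirchSwinnertonDyer.Rank1Residual.Additive
  Summit.BirchSwinnertonDyer.BirchSwinnertonDyer.Theses.TeichmullerTwistDescent
  Summit.BirchSwinnertonDyer.BirchSwinnertonDyer.Theorems

namespace Summit.BirchSwinnertonDyer.BirchSwinnertonDyer.Theorems.TeichmullerTwistDescent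

/-! ### (PS≥11) and PSMU from the registered stubs, `hall` included -/

/-- **(PS≥11) ⟸ the REGISTERED `stub_twistDegreeStep` of AKR's line `birth`** (binders verbatim after
`hnf`, INCLUDING the residue clause `hres` and the universal degree clause `hall`), granted Modularity,
Edixhoven Thm. 3 (both readings), Dokchitser–Dokchitser Thm. 5.1 (1) and Česnavičius–Neururer–Saha
Thm. 1.2: off the proper residue (`¬ hall`) the degree class gives a member with `p ∤ c` (ČNS,
`ManinFrameTransport.exists_modularParametrizationData_not_dvd_of_not_dvd_modularDegree`); on it, §3.
[cite: EdixhovenManin1991, Thm. 3 and §4] [cite: CesnaviciusNeururerSaha2023, Thm. 1.2] -/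
theorem cellPS11_of_registeredTwistDegreeStep
    (hEdx : edixhoven_not_dvd_maninConstant_of_not_potentiallyGoodOrdinary)
    (hEdxK : edixhoven_not_dvd_maninConstant_of_kodairaSymbol_ne)
    (hDD : dokchitser_padicValInt_minimalDiscriminantInt_eq_of_isogeny_of_not_dvd_degree)
    (hCNS : cesnaviciusNeururerSaha_padicVal_maninConstant_le_modularDegree)
    (hnf : exists_isNewformOf)
    (hTDS : ∀ (W : WeierstrassCurve ℚ) [W.IsElliptic] [W.IsGloballyMinimal] (p : ℕ) [Fact p.Prime]
      [NeZero (W.conductorNorm ℤ)], 11 ≤ p → Addv W p → Irr W p →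
      ((p < 11 ∨ ∃ (W' : WeierstrassCurve ℚ) (_ : W'.IsElliptic) (_ : W'.IsGloballyMinimal),
          IsIsogenous W W' ∧ TypeGOrd W' p ∧ padicValInt p W'.minimalDiscriminantInt ≤ 4) ∧
        (∃ (W' : WeierstrassCurve ℚ) (_ : W'.IsElliptic) (_ : W'.IsGloballyMinimal),
          IsIsogenous W W' ∧ ∀ (v : HeightOneSpectrum ℤ) (n : ℕ), natGenerator v = p →
            W'.kodairaSymbolAt v ≠ KodairaSymbol.Istar n)) →
      (∀ (W' : WeierstrassCurve ℚ) [W'.IsElliptic] [W'.IsGloballyMinimal]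
          (D' : ModularParametrizationData W' (W.conductorNorm ℤ)),
          IsIsogenous W W' → p ∣ D'.modularDegree) →
      ∀ (V : WeierstrassCurve ℚ) [V.IsElliptic] [V.IsGloballyMinimal] [NeZero (V.conductorNorm ℤ)]
        (Wf : WeierstrassCurve ℚ) [Wf.IsElliptic] [Wf.IsGloballyMinimal] [NeZero (Wf.conductorNorm ℤ)]
        (C : VariableChange ℚ), IsIsogenous W V → TypeGOrd V p →
        padicValInt p V.minimalDiscriminantInt ≤ 4 →
        C • V.quadraticTwist ((-1 : ℚ) ^ (p / 2) * p) = Wf →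
        ∃ D : ModularParametrizationData V (V.conductorNorm ℤ),
          ∀ Df : ModularParametrizationData Wf (Wf.conductorNorm ℤ),
            padicValNat p D.modularDegree < padicValNat p Df.modularDegree) :
    ∀ (W : WeierstrassCurve ℚ) [W.IsElliptic] [W.IsGloballyMinimal] (p : ℕ) [Fact p.Prime]
      [NeZero (W.conductorNorm ℤ)] (D : ModularParametrizationData W (W.conductorNorm ℤ)),
      11 ≤ p → Addv W p → Irr W p → TypeGOrd W p → padicValInt p W.minimalDiscriminantInt ≤ 4 →
      (∀ z ∈ D.L.lattice, ∃ w ∈ periodLattice D.f, z = D.c * w) → ¬ (p : ℤ) ∣ D.c := by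
  intro W _ _ p _ _ D h11 hadd hirr hG hv4 hlat
  have hp : p.Prime := Fact.out
  have hI : ∀ (v : HeightOneSpectrum ℤ) (n : ℕ), natGenerator v = p →
      W.kodairaSymbolAt v ≠ KodairaSymbol.Istar n :=
    (forall_ne_Istar_iff_placeOf W p).mpr (forall_ne_Istar_of_padicValInt_le_four W p (by omega) hadd hv4)
  have hres : (p < 11 ∨ ∃ (W' : WeierstrassCurve ℚ) (_ : W'.IsElliptic) (_ : W'.IsGloballyMinimal),
        IsIsogenous W W' ∧ TypeGOrd W' p ∧ padicValInt p W'.minimalDiscriminantInt ≤ 4) ∧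
      (∃ (W' : WeierstrassCurve ℚ) (_ : W'.IsElliptic) (_ : W'.IsGloballyMinimal),
        IsIsogenous W W' ∧ ∀ (v : HeightOneSpectrum ℤ) (n : ℕ), natGenerator v = p →
          W'.kodairaSymbolAt v ≠ KodairaSymbol.Istar n) :=
    ⟨Or.inr ⟨W, ‹_›, ‹_›, isIsogenous_self W, hG, hv4⟩, W, ‹_›, ‹_›, isIsogenous_self W, hI⟩
  by_cases hall : ∀ (W' : WeierstrassCurve ℚ) [W'.IsElliptic] [W'.IsGloballyMinimal]
      (D' : ModularParametrizationData W' (W.conductorNorm ℤ)), IsIsogenous W W' → p ∣ D'.modularDegree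
  · exact not_dvd_optimal_of_member W hirr D hlat
      (ManinFrameResidueProperTwistDegree.stub_memberManinUnit_ordinary_of_twistDegreeStep hEdx hEdxK hDD
        hnf W p h11 hadd hirr hres (hTDS W p h11 hadd hirr hres hall))
  · push Not at hall
    obtain ⟨W', hE', hM', D', hiso, hdeg⟩ := hall
    haveI := hE'
    haveI := hM'
    obtain ⟨Dt, hc⟩ :=
      ManinFrameTransport.exists_modularParametrizationData_not_dvd_of_not_dvd_modularDegree hnf hCNS W
        hp (by omega) hirr hiso D' hdeg
    exact not_dvd_optimal_of_member W hirr D hlat ⟨W, ‹_›, ‹_›, Dt, isIsogenous_self W, hc⟩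

/-- **PSMU ⟸ AKR's two REGISTERED stubs (`stub_twistDegreeStep`, `stub_memberManinUnit_fiveSeven`,
binders verbatim after `hnf`), granted the printed facts** — so once the line `birth` of crux 20709
closes its stubs, `exact` closes the T10-restated PSMU. [cite: EdixhovenManin1991, Thm. 3 and §4]
[cite: CesnaviciusNeururerSaha2023, Thm. 1.2] [cite: DokchitserDokchitser2015LocalInvariants, Thm. 5.1 (1)] -/
theorem principalSeriesOptimalManinUnit_of_registeredStubs
    (hEdx : edixhoven_not_dvd_maninConstant_of_not_potentiallyGoodOrdinary)
    (hEdxK : edixhoven_not_dvd_maninConstant_of_kodairaSymbol_ne)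
    (hDD : dokchitser_padicValInt_minimalDiscriminantInt_eq_of_isogeny_of_not_dvd_degree)
    (hCNS : cesnaviciusNeururerSaha_padicVal_maninConstant_le_modularDegree)
    (hnf : exists_isNewformOf)
    (hTDS : ∀ (W : WeierstrassCurve ℚ) [W.IsElliptic] [W.IsGloballyMinimal] (p : ℕ) [Fact p.Prime]
      [NeZero (W.conductorNorm ℤ)], 11 ≤ p → Addv W p → Irr W p →
      ((p < 11 ∨ ∃ (W' : WeierstrassCurve ℚ) (_ : W'.IsElliptic) (_ : W'.IsGloballyMinimal),
          IsIsogenous W W' ∧ TypeGOrd W' p ∧ padicValInt p W'.minimalDiscriminantInt ≤ 4) ∧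
        (∃ (W' : WeierstrassCurve ℚ) (_ : W'.IsElliptic) (_ : W'.IsGloballyMinimal),
          IsIsogenous W W' ∧ ∀ (v : HeightOneSpectrum ℤ) (n : ℕ), natGenerator v = p →
            W'.kodairaSymbolAt v ≠ KodairaSymbol.Istar n)) →
      (∀ (W' : WeierstrassCurve ℚ) [W'.IsElliptic] [W'.IsGloballyMinimal]
          (D' : ModularParametrizationData W' (W.conductorNorm ℤ)),
          IsIsogenous W W' → p ∣ D'.modularDegree) →
      ∀ (V : WeierstrassCurve ℚ) [V.IsElliptic] [V.IsGloballyMinimal] [NeZero (V.conductorNorm ℤ)]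
        (Wf : WeierstrassCurve ℚ) [Wf.IsElliptic] [Wf.IsGloballyMinimal] [NeZero (Wf.conductorNorm ℤ)]
        (C : VariableChange ℚ), IsIsogenous W V → TypeGOrd V p →
        padicValInt p V.minimalDiscriminantInt ≤ 4 →
        C • V.quadraticTwist ((-1 : ℚ) ^ (p / 2) * p) = Wf →
        ∃ D : ModularParametrizationData V (V.conductorNorm ℤ),
          ∀ Df : ModularParametrizationData Wf (Wf.conductorNorm ℤ),
            padicValNat p D.modularDegree < padicValNat p Df.modularDegree)
    (h57 : ∀ (W : WeierstrassCurve ℚ) [W.IsElliptic] [W.IsGloballyMinimal] (p : ℕ) [Fact p.Prime]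
      [NeZero (W.conductorNorm ℤ)], 5 ≤ p → p < 11 → Addv W p → Irr W p →
      ((p < 11 ∨ ∃ (W' : WeierstrassCurve ℚ) (_ : W'.IsElliptic) (_ : W'.IsGloballyMinimal),
          IsIsogenous W W' ∧ TypeGOrd W' p ∧ padicValInt p W'.minimalDiscriminantInt ≤ 4) ∧
        (∃ (W' : WeierstrassCurve ℚ) (_ : W'.IsElliptic) (_ : W'.IsGloballyMinimal),
          IsIsogenous W W' ∧ ∀ (v : HeightOneSpectrum ℤ) (n : ℕ), natGenerator v = p →
            W'.kodairaSymbolAt v ≠ KodairaSymbol.Istar n)) →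
      (∀ (W' : WeierstrassCurve ℚ) [W'.IsElliptic] [W'.IsGloballyMinimal]
          (D' : ModularParametrizationData W' (W.conductorNorm ℤ)),
          IsIsogenous W W' → p ∣ D'.modularDegree) →
      ∃ (W₀ : WeierstrassCurve ℚ) (_ : W₀.IsElliptic) (_ : W₀.IsGloballyMinimal)
        (D₀ : ModularParametrizationData W₀ (W.conductorNorm ℤ)),
        IsIsogenous W W₀ ∧ ¬ (p : ℤ) ∣ D₀.c) :
    PrincipalSeriesOptimalManinUnit :=
  principalSeriesOptimalManinUnit_of_cells hEdxK hnf
    (cellPS11_of_registeredTwistDegreeStep hEdx hEdxK hDD hCNS hnf hTDS)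
    (fun W _ _ p _ _ D hp57 hadd hirr _ hI hlat =>
      cell57_of_memberManinUnit57 hnf hCNS h57 W p D hp57 hadd hirr hI hlat)

end Summit.BirchSwinnertonDyer.BirchSwinnertonDyer.Theorems.TeichmullerTwistDescent

end
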